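import Summits.BirchSwinnertonDyer.BirchSwinnertonDyer.Theorems.ErratumRoadFiveNonSurjCornerHybridSavedOfLabelsB6
import Summits.BirchSwinnertonDyer.BirchSwinnertonDyer.Theorems.ErratumRoadFiveNonSurjCornerSavedDisplayDOfCarrierLabelsB6
import Summits.BirchSwinnertonDyer.BirchSwinnertonDyer.Theorems.ErratumRoadFiveNonSurjCornerLowerHalfNonSurjDoorsContra
import HarnessLib

/-!
# Route `ErratumRoadFive` (rung K2), crux `NonSurjCorner` (item stmt-BirchSwinnertonDyer-19065), registered line `Lines/hybrid.lean`:
# GLUE #12 — glue #11 (fully twin-keyed) with slot 6 THINNED to (B6) ONLY AT THE CARRIER PRIMES outside `S` (tam3-p1 g15's precision frame,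
# corner3-p2 g10's p-generic image-keyed TD producer; Milne *ADT* I.3.8 discharged in the kernel)
# (cell `bsd-stepL`, seat `bsd-stepL-corner-p1` g16; `--supports stmt-BirchSwinnertonDyer-19065 --as helper`)

WHY THIS FILE. Glue #11 (`…HybridContraKeyed`, p620587) asks slot 6 for the label (B6) at every `N⁺`-prime outside `S`; the (B6)-precision route
(tam3-p1 g15 ∕ corner3-p2 g10, registered on 19109 r11 and 21420 r10) needs it only at the CARRIER primes outside `S` (`q ∣ N`, `q ∉ S`, `p ∣ c_q(E)`;
on the corner's up-to-one frames: the single exempted split carrier `q₁`). THIS FILE = glue #11 with `hLabB6 ↦ hLabB6T` (that thinner statement), the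
D-form display produced by `NonSurjCorner.shimuraInertSavedDisplayAtD_of_carrierLabelsB6` (`…SavedDisplayDOfCarrierLabelsB6`, over p621386); body
otherwise byte-identical:
* **glue #12 `nonSurjCorner_of_kolyZShaAn_of_twinMuAn_of_katoContraFacts_of_hidaFacts_of_sixNamedInputs_of_carrierLabelsB6_of_threeBadSplit`**.
Candidate composition of `Lines/hybrid.lean` r10 (slot 6 `stub_shimuraLabelsB6_57` ↦ `stub_shimuraCarrierLabelsB6_57`; slots 1–5, 7 ≡ r9); the r9 statement
implies the r10 one (`NonSurjCorner.carrierLabelsB6_of_labelsB6`), so registering r10 loses nothing. Planner g40 pre-cleared this thinning as bookkeeping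
(09:09:30Z).

HONEST FRAMING: ONE THEOREM (no definition, no named fact, no `sorry`); CONDITIONAL on every displayed binder (as glue #11, with (B6) asked only at the
carriers — still NOT a theorem of the tree nor in print as such on `X_{N⁺,N⁻}`); item 19065 is NOT closed; no stub is discharged; nothing about any
curve's BSD; BSD is not advanced; T7. Credit: tam3-p1 g15, lane B corner3-p2 g9–g10, bsd-2adic tower-1 g19, defn-ty1 g18, bsd-line-er5-p2, planner g39∕g40.
References (locators only): [cite: Jetchev2008, Thm. 1.1, Cor. 1.5] [cite: McCallumLMS1991, Cor. 5.6] [cite: MilneADT2006, Ch. I Prop. 3.8] [cite: Kato2004Asterisque, §17.13]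
[cite: EmertonPollackWeston2006, Thm. 5.1.3] [cite: Wan2015, Thm. 4] [cite: Miller2011LMS, Def. 1.1].
-/

set_option autoImplicit false
set_option linter.dupNamespace false -- `Summit.BirchSwinnertonDyer.BirchSwinnertonDyer` (summit = problem), tree-wide

noncomputable section

open scoped Classical NumberField MatrixGroups ModularForm

namespace Summit.BirchSwinnertonDyer.BirchSwinnertonDyer.Theorems

open CongruenceSubgroup WeierstrassCurve NumberField IsDedekindDomain Field Rat.HeightOneSpectrum
  Literature.NumberTheory.EllipticCurves
  Literature.NumberTheory.EllipticCurves.ModularForms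
  Literature.NumberTheory.Automorphic
  Literature.NumberTheory.EllipticCurves.Rank1Residual
  Literature.NumberTheory.EllipticCurves.Rank1Residual.Typed
  Literature.NumberTheory.EllipticCurves.Wuthrich2014
  Literature.NumberTheory.EllipticCurves.SteinWuthrich2013
  Literature.NumberTheory.EllipticCurves.Greenberg1999
  Literature.NumberTheory.EllipticCurves.Kato2004
  Literature.NumberTheory.EllipticCurves.BarriosEtAl2025
  Literature.NumberTheory.EllipticCurves.EmertonPollackWeston2006
  Literature.NumberTheory.EllipticCurves.ShimuraCMFamily
  Literature.NumberTheory.GaloisRepresentations Literature.NumberTheory.GaloisCohomology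
  Summit.BirchSwinnertonDyer.Rank1Residual
  Summit.BirchSwinnertonDyer.Rank1Residual.X11b
  Summit.BirchSwinnertonDyer.Rank1Residual.X11b.Three.Koly

/-- **THE HYBRID GLUE (glue #12) — FULLY TWIN-KEYED, (B6) ONLY AT THE CARRIERS.** As glue #11 (`…HybridContraKeyed`) with the slot-6 binder
thinned to «(B6) at each `q ∣ N`, `q ∉ S` with `p ∣ c_q(E)`» (`hLabB6T`) and the D-form display produced by
`NonSurjCorner.shimuraInertSavedDisplayAtD_of_carrierLabelsB6`; everything else VERBATIM. As glue #10 (`…HybridSavedOfLabelsB6`) with the fact bundle `hF` (item 19949 BY NAME) replaced by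
`hF′`: the same twenty-three named facts with Kato's §17.13 construction facts at `p ∥ N` taken in their PRINT-EXACT contragredient form
(`Kato2004.exists_multDivisibilityInputs_{nonsplit,split,fine}_contra`); the typed divisibility at the leaf twins comes from
`X11b.multDivisibilityAt_of_katoFacts_of_muAn_contra` (bsd-2adic's VII′ + the multiplicative functional equation BY NAME + this seat's μ-road re-key), the
leaf-twin lower half from `NonSurjChain.lowerNonSurj_fiveSeven_of_nonSurjCornerTwinMuAn_of_contraFacts`. Binders: `hZan` → 19948 → `hF′` → `hHida` →
hMax → hShim6 → `hLabB6` → `hres3bad` → `NonSurjCorner`. CONDITIONAL on every binder; 19065 NOT closed; nothing booked; T7.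
[cite: Kato2004Asterisque, §17.13 (pp. 279–280)] [cite: MazurTateTeitelbaum1986Invent, §I.17] [cite: Jetchev2008, Thm. 1.1 and Cor. 1.5]
[cite: EmertonPollackWeston2006, Thm. 5.1.3] [cite: Miller2011LMS, Def. 1.1] [cite: Cha2005, Thm. 21 and Rmk. 25] [cite: JetchevSkinnerWan2017, §7.4.2] -/
theorem nonSurjCorner_of_kolyZShaAn_of_twinMuAn_of_katoContraFacts_of_hidaFacts_of_sixNamedInputs_of_carrierLabelsB6_of_threeBadSplit
    (hZan : ∀ (W : WeierstrassCurve ℚ) [W.IsElliptic] [W.IsGloballyMinimal] (p : ℕ) [Fact p.Prime]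
      (N : ℕ) [NeZero N] (K : Type) [Field K] [NumberField K]
      (Dt : ModularParametrizationData W N) (β : ℤ) (ι : K →+* ℂ),
      ClassX11b W p → ¬ Surj W p → (p = 5 ∨ p = 7) → p ∣ padicValInt p W.minimalDiscriminantInt →
      ¬ Ram W p → (∃ s : ℚ, shaAn W = (s : ℂ) ∧ 0 < padicValRat p s) →
      W.conductorNorm ℤ = N → IsImaginaryQuadratic K →
      4 < (NumberField.discr K).natAbs → SatisfiesHeegnerHypothesis N K →
      SatisfiesHeegnerHypothesis p K → (4 * (N : ℤ)) ∣ β ^ 2 - NumberField.discr K → ¬ (p : ℤ) ∣ Dt.c →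
      (∃ (d₁ : KolyvaginHeegnerData Dt β ι 1) (y : (W.baseChange K).toAffine.Point),
        WeierstrassCurve.Affine.Point.map (W' := W) (algebraMap K (ringClassField K ι 1)).toRatAlgHom y =
          d₁.derivedPoint ∧
        ∃ Q : (W.baseChange K).toAffine.Point, ((p ^ (padicValNat p W.tamagawaProduct + 1) : ℕ) : ℤ) • Q = y) →
      ∃ M : ℕ, M ≤ padicValNat p W.tamagawaProduct ∧ CertificateAt Dt β ι p M)
    (hμ : NonSurjCornerTwinMuAn)
    -- slot 3 (r9): item 19949's twenty-three named facts with the three Kato §17.13 construction facts V ∕ VI ∕ XI REPLACED by their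
    -- print-exact contragredient twins V′ ∕ VI′ ∕ XI′ (p604443) — the text of a repaired support item `KatoTwinFactsFiveAnContra` (planner's call)
    (hF' :
      (∀ (N : ℕ) [NeZero N] (W : WeierstrassCurve ℚ) (K : Type) [Field K] [NumberField K], Literature.NumberTheory.EllipticCurves.gross_zagier N W K) ∧
      (∀ (N : ℕ) [NeZero N] (W : WeierstrassCurve ℚ) (K : Type) [Field K] [NumberField K], Literature.NumberTheory.EllipticCurves.kolyvagin N W K) ∧
      Literature.NumberTheory.EllipticCurves.Wuthrich2014.sha_dvd_analyticSha ∧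
      Literature.NumberTheory.EllipticCurves.rank_eq_analyticRank_of_analyticRank_le_one ∧
      WeierstrassCurve.hasEntireLFunction_rat ∧
      Literature.NumberTheory.EllipticCurves.ModularForms.exists_isNewformOf ∧
      Literature.NumberTheory.EllipticCurves.ModularForms.nonempty_modularParametrizationData ∧
      Literature.NumberTheory.EllipticCurves.friedbergHoffstein_exists_heegnerField_split_twist_ne_zero ∧
      Literature.NumberTheory.EllipticCurves.ModularForms.mazur_not_dvd_maninConstant_of_odd ∧
      (∀ (N : ℕ) [NeZero N] (W : WeierstrassCurve ℚ) (K : Type) [Field K] [NumberField K], Literature.NumberTheory.EllipticCurves.heegnerPointOfConductor_one_galoisConj N W K) ∧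
      (∀ (N : ℕ) [NeZero N] (W : WeierstrassCurve ℚ) (K : Type) [Field K] [NumberField K], Literature.NumberTheory.EllipticCurves.phi_heegnerTau_mem_singularModuliField N W K) ∧
      Literature.NumberTheory.EllipticCurves.SteinWuthrich2013.thm61_splitMultiplicative ∧
      Literature.NumberTheory.EllipticCurves.SteinWuthrich2013.thm61_nonsplitMultiplicative ∧
      (∀ (W : WeierstrassCurve ℚ) [W.IsElliptic] [W.IsGloballyMinimal] (p : ℕ) [Fact p.Prime], Literature.NumberTheory.EllipticCurves.greenberg_stevens (W := W) (p := p)) ∧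
      Literature.NumberTheory.EllipticCurves.Cha2005.rmk25_pow_dvd_card_sha_primary_of_certificate ∧
      Literature.NumberTheory.EllipticCurves.Cha2005.rmk25_padicValNat_card_sha_primary_add_le_of_globalDivisibility ∧
      Literature.NumberTheory.EllipticCurves.Kato2004.nonempty_iwasawaH1Data ∧
      Literature.NumberTheory.EllipticCurves.Kato2004.thm12_4 ∧
      Literature.NumberTheory.EllipticCurves.Kato2004.exists_multDivisibilityInputs_nonsplit_contra ∧
      Literature.NumberTheory.EllipticCurves.Kato2004.exists_multDivisibilityInputs_split_contra ∧
      Literature.NumberTheory.EllipticCurves.Greenberg1999.thm15_isTorsion_multiplicative_rat ∧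
      Literature.NumberTheory.EllipticCurves.Wuthrich2014.corollary18_padicLFunction_mem_iwasawaAlgebra_multiplicative ∧
      Literature.NumberTheory.EllipticCurves.Kato2004.exists_multDivisibilityInputs_fine_contra)
    -- slot 4 (r7): the six Hida-side NAMED facts of x11a's non-surjective chain
    (hHida : EmertonPollackWeston2006.thm311_cotorsion_weightK_member_ofLevel ∧
      EmertonPollackWeston2006.thm1_muAlg_of_weightK_member_ofLevel ∧
      Wan2015.thm4_rational_weightK_member_of_bdd_ofLevel_irred ∧
      EmertonPollackWeston2006.thm513_transfer_from_weightK_member_of_bdd_ofLevel ∧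
      DeligneSerre1974.thm61_exists_adicGaloisRep ∧ Hida2000_thm326_ordinary)
    (hMax : GrossLMS1991.prop37_2_frobeniusCongruence ∧
      (∀ (K : Type) [Field K] [NumberField K], poitouTate_selmerStructure_duality_conj K) ∧
      Gross1991_heegnerPoint_sub_ratTorsion_mem_E0_imageFree)
    (hShim6 : friedbergHoffstein_exists_twist_ne_zero_inertAt ∧ nonempty_shimuraParametrizationData ∧
      PastenShimura2024_componentOrders ∧
      (∀ (K : Type) [Field K] [NumberField K], casselsTate_levelInputs K) ∧
      shimuraCurve_heegnerSystem_primitivesFromFiveIrr ∧ shimuraCurve_heegnerSystem_primitivesSplitReduced)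
    -- slot 6 (r10): the labelled CM family at the corner's inert frames with `d_K < −4`, WITH (B6) ONLY AT THE CARRIER PRIMES outside `S`
    (hLabB6T : ∀ (W : WeierstrassCurve ℚ) [W.IsElliptic] [W.IsGloballyMinimal] (p : ℕ) [Fact p.Prime],
      ClassX11b W p → ¬ Surj W p → (p = 5 ∨ p = 7) →
      ∀ (N : ℕ) [NeZero N] (K : Type) [Field K] [NumberField K] (S : Finset ℕ) (Dt : ModularParametrizationData W N)
        (X : ShimuraCurveData (∏ q ∈ S, q) (N / ∏ q ∈ S, q)) (W' : WeierstrassCurve ℚ) [W'.IsElliptic]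
        (P₀ : ShimuraParametrizationData X W'),
        W.conductorNorm ℤ = N → IsImaginaryQuadratic K → NumberField.discr K < -4 → Even S.card →
        (∀ ℓ ∈ S, ℓ.Prime ∧ ℓ ∣ N ∧ ¬ ℓ ^ 2 ∣ N ∧
          ((Ideal.span {(ℓ : ℤ)}).primesOver (𝓞 K)).ncard = 1 ∧ ¬ (ℓ : ℤ) ∣ NumberField.discr K) →
        (∀ ℓ : ℕ, ℓ.Prime → ℓ ∣ N → ℓ ∉ S → ((Ideal.span {(ℓ : ℤ)}).primesOver (𝓞 K)).ncard = 2) →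
        p ∈ S → ¬ (p : ℤ) ∣ Dt.c → P₀.IsMinimalFor W →
        ∃ (ι : K →+* ℂ) (y : (W.baseChange K).toAffine.Point) (degy : ℕ)
          (ys : (m : ℕ) → (W.baseChange (ringClassField K ι m)).toAffine.Point) (ε : ℤ), 0 < degy ∧
          padicValNat p degy = padicValNat p P₀.deg ∧
          LDerivEK W K = 8 * (Real.pi : ℂ) ^ 2 * peterssonProduct (CongruenceSubgroup.Gamma0 N) 2 Dt.f Dt.f /
              ((((Units.torsionOrder K : ℝ) / 2) ^ 2 * √|(NumberField.discr K : ℝ)| : ℝ) : ℂ) *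
            ((y.canonicalHeight : ℂ) / (degy : ℂ)) ∧
          (¬ IsOfFinAddOrder y → 0 < (AddSubgroup.zmultiples y).index) ∧
          ShimuraWalk.LabelsAt W N K ι y ys ε ∧
          ∀ (q : ℕ) [Fact q.Prime], q ∣ N → q ∉ S → p ∣ (W.baseChange ℚ_[q]).localTamagawaNumber ℤ_[q] → LabelB6 ι W N {q} ys)
    (hres3bad : ∀ (W : WeierstrassCurve ℚ) [W.IsElliptic] [W.IsGloballyMinimal] (p : ℕ) [Fact p.Prime],
      ClassX11b W p → ¬ Surj W p → (p = 5 ∨ p = 7) → p ∣ padicValInt p W.minimalDiscriminantInt → ¬ Ram W p →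
      ∀ (q₁ q₂ q₃ : ℕ) [Fact q₁.Prime] [Fact q₂.Prime] [Fact q₃.Prime], q₁ ≠ p → q₂ ≠ p → q₃ ≠ p →
      q₁ ≠ q₂ → q₁ ≠ q₃ → q₂ ≠ q₃ →
      W.HasSplitMultiplicativeReductionAtPrime q₁ → W.HasSplitMultiplicativeReductionAtPrime q₂ →
      W.HasSplitMultiplicativeReductionAtPrime q₃ →
      (q₁ = 2 ∨ p ∣ q₁ - 1) → (q₂ = 2 ∨ p ∣ q₂ - 1) → (q₃ = 2 ∨ p ∣ q₃ - 1) → Typed.MissingUpperBoundAt W p) :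
    Summit.BirchSwinnertonDyer.BirchSwinnertonDyer.Theses.ErratumRoadFive.NonSurjCorner := by
  obtain ⟨hGZ, hKo, hWu, hGZK, hmod, hnf, hpar, hFHs, hMaz, hrec, hD36, hJs, hJn, hGS, hChaL, hChaU, hne, h12,
    hns', hsp', h15, h18, hfine'⟩ := hF'
  obtain ⟨h311, hT1a, hT2, hT1b, h61, h326⟩ := hHida
  obtain ⟨h37, hPTs, hF1⟩ := hMax
  obtain ⟨hFH, hJL, hCO, hCT, hLab, hLabS⟩ := hShim6
  have hPT : ∀ (K : Type) [Field K] [NumberField K],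
      Literature.NumberTheory.GaloisCohomology.poitouTate_sum_localTatePairing_eq_zero K :=
    poitouTate_sum_localTatePairing_eq_zero_holds
  have hBR : localTamagawaNumber_quadraticTwist_two_mem_of_goodReduction :=
    BarriosEtAl2025.localTamagawaNumber_quadraticTwist_two_mem_of_goodReduction_holds
  -- slot 4: the leaf-twin lower half from 19948 + named facts (er5-p2's non-surjective Hida chain, CONTRA-keyed doors p619004)
  have h₄ℓ : ∀ (Wd : WeierstrassCurve ℚ) [Wd.IsElliptic] [Wd.IsGloballyMinimal] (p : ℕ) [Fact p.Prime],
      ClassX11a Wd p → ¬ Surj Wd p → (p = 5 ∨ p = 7) → p ∣ padicValInt p Wd.minimalDiscriminantInt →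
      ¬ X11a.ShaAnUnit Wd p → Typed.MissingLowerBoundAt Wd p :=
    fun Wd _ _ p _ hXa hnsd h57 _ _ ↦
      NonSurjChain.lowerNonSurj_fiveSeven_of_nonSurjCornerTwinMuAn_of_contraFacts hnf h311 hT1a hT2 hT1b h61 h326 h12 hns' hsp' h15
        h18 hfine' hJs hJn hGZK hGS hμ Wd p hXa hnsd h57
  -- slot 6 (r10): the SAVED display in D-form at every corner pair and every `q₁`, from the labels with (B6) at the CARRIERS, Poitou–Tate and CT
  have hSavD : ∀ (W : WeierstrassCurve ℚ) [W.IsElliptic] [W.IsGloballyMinimal] (p : ℕ) [Fact p.Prime],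
      ClassX11b W p → ¬ Surj W p → (p = 5 ∨ p = 7) → ∀ (q₁ : ℕ) [Fact q₁.Prime], ShimuraInertSavedDisplayAtD W p q₁ :=
    NonSurjCorner.shimuraInertSavedDisplayAtD_of_carrierLabelsB6 hPTs hCT hLabB6T
  exact X11b.erratumRoadFive_nonSurjCorner_of_kolyZShaAn_of_kolyJMax_of_multiUpper_of_lowerLeafTwinDeep_of_twinMultDivisibility hGZ hKo
    hWu hGZK hmod hnf hpar hFHs hMaz hrec hD36 hJs hJn hGS hChaL hChaU h₄ℓ hZan
    (X11b.Three.Koly.nonSurjCornerKolyJ_max_of_threeNamedFacts h37 hPTs hF1)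
    (fun W _ _ p _ hX hns' h57 hv hnr htam hmulti ↦ by
      -- the TWIN-LOWER SUPPLY at this corner pair (Friedberg–Hoffstein + the leaf-twin lower half)
      have hTL : FHTwinLowerSupplyAt W p :=
        NonSurjCorner.fhTwinLowerSupplyAt_of_lowerLeafTwinDeep hGZK hmod hnf hFH h₄ℓ W p hX hns' h57 hv hnr
      by_cases h3 : ∃ (q₁ q₂ q₃ : ℕ) (_ : Fact q₁.Prime) (_ : Fact q₂.Prime) (_ : Fact q₃.Prime), q₁ ≠ p ∧ q₂ ≠ p ∧ q₃ ≠ p ∧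
          q₁ ≠ q₂ ∧ q₁ ≠ q₃ ∧ q₂ ≠ q₃ ∧ W.HasSplitMultiplicativeReductionAtPrime q₁ ∧
          W.HasSplitMultiplicativeReductionAtPrime q₂ ∧ W.HasSplitMultiplicativeReductionAtPrime q₃ ∧
          (q₁ = 2 ∨ p ∣ q₁ - 1) ∧ (q₂ = 2 ∨ p ∣ q₂ - 1) ∧ (q₃ = 2 ∨ p ∣ q₃ - 1)
      · obtain ⟨q₁, q₂, q₃, i₁, i₂, i₃, h1p, h2p, h3p, h12', h13, h23, hs1, hs2, hs3, hb1, hb2, hb3⟩ := h3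
        haveI := i₁; haveI := i₂; haveI := i₃
        exact hres3bad W p hX hns' h57 hv hnr q₁ q₂ q₃ h1p h2p h3p h12' h13 h23 hs1 hs2 hs3 hb1 hb2 hb3
      · have hno : ∀ (q₁ q₂ q₃ : ℕ) [Fact q₁.Prime] [Fact q₂.Prime] [Fact q₃.Prime], q₁ ≠ p → q₂ ≠ p → q₃ ≠ p →
            q₁ ≠ q₂ → q₁ ≠ q₃ → q₂ ≠ q₃ →
            W.HasSplitMultiplicativeReductionAtPrime q₁ → W.HasSplitMultiplicativeReductionAtPrime q₂ →
            W.HasSplitMultiplicativeReductionAtPrime q₃ →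
            (q₁ = 2 ∨ p ∣ q₁ - 1) → (q₂ = 2 ∨ p ∣ q₂ - 1) → (q₃ = 2 ∨ p ∣ q₃ - 1) → False :=
          fun q₁ q₂ q₃ _ _ _ h1p h2p h3p h12' h13 h23 hs1 hs2 hs3 hb1 hb2 hb3 ↦
            h3 ⟨q₁, q₂, q₃, inferInstance, inferInstance, inferInstance, h1p, h2p, h3p, h12', h13, h23, hs1, hs2, hs3,
              hb1, hb2, hb3⟩
        rcases NonSurjCorner.admissibleUpToOneDatum_of_atMostTwoBadSplit W p hX hns' h57 htam hmulti hno with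
          hadm | ⟨q₁, hq₁F, hq₁, hdat⟩
        · exact NonSurjCorner.missingUpperBoundAt_of_admissibleSet_of_primitives_of_twinLower hGZK hmod hnf hMaz hBR hJL hCO hPT hCT
            hLab hLabS W p hX h57 hTL hadm
        · haveI := hq₁F
          exact NonSurjCorner.missingUpperBoundAt_of_admissibleUpToOne_of_savedDisplayD_of_twinLower hGZK hmod hnf hMaz hBR hJL hCO W p
            hX h57 hTL q₁ hq₁ (hSavD W p hX hns' h57 q₁) hdat)
    (fun Wd _ _ p _ hXa hnsd h57 hvd ↦
      X11b.multDivisibilityAt_of_katoFacts_of_muAn_contra hne h12 hnf hns' hsp' h15 h18 hfine' Wd p hXa.2.1 hXa.2.2.1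
        hXa.2.2.2.1 hnsd (fun f hf ϖ hϖ a L hsa hna hL ↦ hμ Wd p hXa hnsd h57 hvd f hf ϖ hϖ a L hsa hna hL))

end Summit.BirchSwinnertonDyer.BirchSwinnertonDyer.Theorems

end
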